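import Summits.CriticalPhenomena.CardyFormulaZ2.Theses.CardySelfRefinement
import Literature.Probability.LatticeModels.DobrushinDiscretisation
import Literature.Probability.RandomPlanarGeometry.MarkedDomainCorners
import HarnessLib

/-!
# Marker families and the arc gap: partial helper for stub `stub_discretisable` of line `crosscut-dictionary` for crux `LagHandOff` (stmt-CriticalPhenomena-10268)

Two pieces of glue that every proof of `stub_discretisable`
(`∀ D : DobrushinDomain, ∃ E, ZdDiscretisationFamily D E`) goes through.

* `zdDiscretisationFamily_mk_iff`, `stub_discretisable_iff_markers`: the fields `Ω_eq`, `δ_eq` of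
  `ZdDiscretisationFamily` pin the data to `⟨D.carrier, δ, A δ, B δ⟩`, so the stub is EQUIVALENT to
  producing two MARKER FAMILIES `A B : ℝ → Set ℂ` which Hausdorff-converge to the arcs `(ab)`,
  `(ba)`, make the data admissible for all small meshes and make the discrete marked points
  converge — the analogue of `zdDiscretisationFamily_dobrushinData_iff`
  (`Percolation/InterfaceCurves.lean`) for perturbed markers (the canonical markers `D.arc 0`,
  `D.arc 1` create ties, `Percolation/CanonicalDiscretisationTies.lean`).
* `exists_pos_le_infDist_arc`: away from the two marked points the arcs are uniformly separated —
  for `ρ > 0` there is `c > 0` with `infDist z (arc (i+1)) ≥ c` for every `z ∈ arc i` at distance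
  `≥ ρ` from both marked points (compactness + `MarkedDomain.mem_arc_inter_arc`).  With
  `exists_frontier_near_of_mem_zdBoundary₀` / `infDist_le_dist_of_mem_zdDiscreteArc`
  (`LatticeModels/BoundaryValues.lean`) this is what confines the freedom in the choice of the
  markers to the `o(1)`-neighbourhoods of `a` and `b`: for `4δ < c`, a boundary site whose mesh
  point is farther than `ρ + 2δ` from `a`, `b` and within `2δ` of `arc i` is farther than `2δ` from
  `arc (i+1)`, hence is selected by no marker set lying within `c - 4δ` of `arc (i+1)`.
-/

noncomputable section

open MeasureTheory Filter Set Topology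
open scoped BoundedContinuousFunction
open Literature.Probability.Percolation Literature.Probability.LatticeModels
open Literature.Probability.RandomPlanarGeometry Literature.Probability.Percolation.QuadCrossing
open Summit.CriticalPhenomena.CardyFormulaZ2.Theses.CardySelfRefinement

namespace Summit.CriticalPhenomena.CardyFormulaZ2.Cruxes.LagHandOff.CrosscutDictionary

/-! ### The stub is a statement about marker families -/

/-- Data of the form `⟨D.carrier, δ, A δ, B δ⟩` discretise `(D; a, b)` iff the markers
Hausdorff-converge to the two arcs, the discrete marked points converge to `{a, b}` and the data
are eventually admissible (the fields `Ω_eq`, `δ_eq` hold by `rfl`). [folklore] -/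
theorem zdDiscretisationFamily_mk_iff (D : DobrushinDomain) (A B : ℝ → Set ℂ) :
    ZdDiscretisationFamily D (fun δ => (⟨D.carrier, δ, A δ, B δ⟩ : DiscreteDobrushin)) ↔
      Tendsto (fun δ => Metric.hausdorffEDist (A δ) (D.arc 0)) (𝓝[>] 0) (𝓝 0) ∧
      Tendsto (fun δ => Metric.hausdorffEDist (B δ) (D.arc 1)) (𝓝[>] 0) (𝓝 0) ∧
      Tendsto (fun δ => Metric.hausdorffEDist
        (medialPoint δ '' (⟨D.carrier, δ, A δ, B δ⟩ : DiscreteDobrushin).zdABEdges) {D.pt 0, D.pt 1})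
        (𝓝[>] 0) (𝓝 0) ∧
      ∀ᶠ δ in 𝓝[>] (0 : ℝ), (⟨D.carrier, δ, A δ, B δ⟩ : DiscreteDobrushin).IsZdAdmissible :=
  ⟨fun h => ⟨h.tendsto_arcA, h.tendsto_arcB, h.tendsto_zdABEdges, h.eventually_isZdAdmissible⟩,
    fun h => ⟨fun _ => rfl, fun _ => rfl, h.1, h.2.1, h.2.2.1, h.2.2.2⟩⟩

/-- A discretisation family is the family of its own markers on the canonical domain and mesh:
`E = fun δ ↦ ⟨D.carrier, δ, (E δ).arcA, (E δ).arcB⟩`. [folklore] -/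
theorem zdDiscretisationFamily_eq_mk {D : DobrushinDomain} {E : ℝ → DiscreteDobrushin}
    (h : ZdDiscretisationFamily D E) :
    (fun δ => (⟨D.carrier, δ, (E δ).arcA, (E δ).arcB⟩ : DiscreteDobrushin)) = E := by
  funext δ
  have h1 := h.Ω_eq δ
  have h2 := h.δ_eq δ
  rcases hE : E δ with ⟨Ω, d, a, b⟩
  simp only [hE] at h1 h2 ⊢
  rw [h1, h2]

/-- **`stub_discretisable` is a statement about markers.** Every Dobrushin domain carries a
`ZdDiscretisationFamily` iff every Dobrushin domain carries marker families `A B : ℝ → Set ℂ`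
whose data `⟨D.carrier, δ, A δ, B δ⟩` form one; by `zdDiscretisationFamily_mk_iff` the latter
means: Hausdorff convergence of the markers to the arcs, convergence of the discrete marked
points, eventual admissibility. [folklore] -/
theorem stub_discretisable_iff_markers :
    (∀ D : DobrushinDomain, ∃ E : ℝ → DiscreteDobrushin, ZdDiscretisationFamily D E) ↔
      ∀ D : DobrushinDomain, ∃ A B : ℝ → Set ℂ,
        ZdDiscretisationFamily D (fun δ => (⟨D.carrier, δ, A δ, B δ⟩ : DiscreteDobrushin)) := by
  refine ⟨fun h D => ?_, fun h D => ?_⟩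
  · obtain ⟨E, hE⟩ := h D
    refine ⟨fun δ => (E δ).arcA, fun δ => (E δ).arcB, ?_⟩
    rw [zdDiscretisationFamily_eq_mk hE]
    exact hE
  · obtain ⟨A, B, hAB⟩ := h D
    exact ⟨_, hAB⟩

/-! ### The arc gap away from the marked points -/

/-- **Arc gap.** For a marked domain with two marked points and `ρ > 0` there is `c > 0` such
that every point of `arc i` at distance `≥ ρ` from both endpoints `pt i`, `pt (i + 1)` is at
distance `≥ c` from the other arc `arc (i + 1)`: the two arcs are compact and meet only at the
marked points (`MarkedDomain.mem_arc_inter_arc`). [folklore] -/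
theorem exists_pos_le_infDist_arc (D : DobrushinDomain) (i : Fin 2) {ρ : ℝ} (hρ : 0 < ρ) :
    ∃ c > 0, ∀ z ∈ D.arc i, ρ ≤ dist z (D.pt i) → ρ ≤ dist z (D.pt (i + 1)) →
      c ≤ Metric.infDist z (D.arc (i + 1)) := by
  have hik : i + 1 ≠ i := by revert i; decide
  set K : Set ℂ := D.arc i ∩ {z | ρ ≤ dist z (D.pt i)} ∩ {z | ρ ≤ dist z (D.pt (i + 1))} with hK
  have hKc : IsCompact K :=
    ((D.isCompact_arc i).inter_right
      (isClosed_le continuous_const (continuous_id.dist continuous_const))).inter_right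
      (isClosed_le continuous_const (continuous_id.dist continuous_const))
  have hpos : ∀ z ∈ K, 0 < Metric.infDist z (D.arc (i + 1)) := by
    rintro z ⟨⟨hz, h1⟩, h2⟩
    change ρ ≤ dist z (D.pt i) at h1
    change ρ ≤ dist z (D.pt (i + 1)) at h2
    rw [← (D.isClosed_arc (i + 1)).notMem_iff_infDist_pos ⟨_, D.pt_mem_arc_self (i + 1)⟩]
    intro hz'
    rcases D.mem_arc_inter_arc hik hz hz' with h | h
    · rw [h, dist_self] at h1
      exact absurd h1 (not_le.2 hρ)
    · rw [h, dist_self] at h2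
      exact absurd h2 (not_le.2 hρ)
  rcases K.eq_empty_or_nonempty with hKe | hKne
  · refine ⟨1, one_pos, fun z hz h1 h2 => ?_⟩
    have : z ∈ K := ⟨⟨hz, h1⟩, h2⟩
    rw [hKe] at this
    exact absurd this (notMem_empty z)
  obtain ⟨z₀, hz₀, hmin⟩ :=
    hKc.exists_isMinOn hKne (Metric.continuous_infDist_pt (D.arc (i + 1))).continuousOn
  exact ⟨_, hpos z₀ hz₀, fun z hz h1 h2 => (isMinOn_iff.1 hmin) z ⟨⟨hz, h1⟩, h2⟩⟩

/-- **Arc gap, both arcs at once.** For `ρ > 0` there is `c > 0` such that a point of one arc at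
distance `≥ ρ` from `a = pt 0` and from `b = pt 1` is at distance `≥ c` from the other arc.
[folklore] -/
theorem exists_pos_le_infDist_arc' (D : DobrushinDomain) {ρ : ℝ} (hρ : 0 < ρ) :
    ∃ c > 0, ∀ i : Fin 2, ∀ z ∈ D.arc i, ρ ≤ dist z (D.pt 0) → ρ ≤ dist z (D.pt 1) →
      c ≤ Metric.infDist z (D.arc (i + 1)) := by
  obtain ⟨c₀, hc₀, h₀⟩ := exists_pos_le_infDist_arc D 0 hρ
  obtain ⟨c₁, hc₁, h₁⟩ := exists_pos_le_infDist_arc D 1 hρ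
  refine ⟨min c₀ c₁, lt_min hc₀ hc₁, fun i z hz ha hb => ?_⟩
  fin_cases i
  · exact (min_le_left _ _).trans (h₀ z hz ha hb)
  · exact (min_le_right _ _).trans (h₁ z hz hb ha)

/-! ### Registered sub-goals (one-line signatures, verbatim) -/

/-- **Registered sub-goal `stub_discretisable_iffMarkers` of `stub_discretisable`**: the stub is
equivalent to the existence of marker families on the canonical domain
(`stub_discretisable_iff_markers`). [folklore] -/
theorem stub_discretisable_iffMarkers : (∀ D : DobrushinDomain, ∃ E : ℝ → DiscreteDobrushin, ZdDiscretisationFamily D E) ↔ ∀ D : DobrushinDomain, ∃ A B : ℝ → Set ℂ, ZdDiscretisationFamily D (fun δ => (⟨D.carrier, δ, A δ, B δ⟩ : DiscreteDobrushin)) :=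
  stub_discretisable_iff_markers

/-- **Registered sub-goal `stub_discretisable_arcGap` of `stub_discretisable`**: uniform
separation of the two arcs of a Dobrushin domain away from the marked points
(`exists_pos_le_infDist_arc'`). [folklore] -/
theorem stub_discretisable_arcGap : ∀ (D : DobrushinDomain) (ρ : ℝ), 0 < ρ → ∃ c > 0, ∀ i : Fin 2, ∀ z ∈ D.arc i, ρ ≤ dist z (D.pt 0) → ρ ≤ dist z (D.pt 1) → c ≤ Metric.infDist z (D.arc (i + 1)) :=
  fun D _ hρ => exists_pos_le_infDist_arc' D hρ

end Summit.CriticalPhenomena.CardyFormulaZ2.Cruxes.LagHandOff.CrosscutDictionary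

end
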